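import Literature.AlgebraicGeometry.Motives.UniversalHypersurfaceRegularLocusTopology
import Literature.Geometry.Manifold.CompactSupportFlow
import Mathlib.Geometry.Manifold.VectorBundle.ContMDiffSection
import HarnessLib

/-!
# Complete flows of cut-off vector fields on `𝒴°(ℂ)`

Family `hodge`, layer `Literature/AlgebraicGeometry/Motives`; the instantiation of the compact-support flow theorem
`Geometry/Manifold/CompactSupportFlow.exists_contMDiff_globalFlow_of_eq_zero_off_isCompact` on the complex manifold `𝒴°(ℂ)` of the regular locus of
the universal hypersurface (Hausdorff, σ-compact, boundaryless: `UniversalHypersurfaceRegularLocusTopology`), for fields of the form `f • X` with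
`X` a `C^∞` vector field (e.g. the shell-tangent lifts of `HodgeTheory/CyclicCoverPencilShellFields`) and `f` a `C^∞` real function vanishing off a
compact set (product of coefficient-disc and node cut-offs; compactness from `UniversalHypersurfaceTotalSpaceOverProper`):

* `contMDiff_smul_tangentField` — `f • X` is a `C^∞` vector field;
* `exists_globalFlow_smul_of_isCompact` — **`f • X` has a complete `C^∞` flow `θ : ℝ × 𝒴°(ℂ) → 𝒴°(ℂ)`, `θ₀ = id`, `θ_t ∘ θ_s = θ_{t+s}`, with
  integral curves `t ↦ θ(t, Q)`, fixing every zero of `f • X`.**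

Everything is proved; no definitions, no named facts.

## References

* [LeeSmoothManifolds2013] J. M. Lee, Introduction to Smooth Manifolds (2013), Thm. 9.16 (compactly supported fields are complete), Lemma 8.6.
* [BrockerJanichIDT1982] T. Bröcker, K. Jänich, Introduction to Differential Topology (1982), §8.
-/

noncomputable section

open CategoryTheory AlgebraicGeometry TopologicalSpace Set Topology Bundle
open scoped Manifold ContDiff
open Literature.Geometry.Manifold

namespace Literature.AlgebraicGeometry.Motives.UniversalHypersurface

variable (n d : ℕ)

/-- **`f • X` is `C^∞`** for a `C^∞` real function `f` and a `C^∞` vector field `X` on `𝒴°(ℂ)`. [cite: LeeSmoothManifolds2013, Lemma 8.6] -/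
theorem contMDiff_smul_tangentField (hd : 0 < d)
    (X : haveI := locallyOfFiniteType_regularTotal_hom ℂ n d hd
      haveI := smoothOfRelativeDimension_regularTotal_hom ℂ n d hd
      letI := ComplexPoints.chartedSpace (regularTotal ℂ n d) (n + Fintype.card (DegIndex n d))
      Π Q : ComplexPoints (regularTotal ℂ n d), TangentSpace (𝓡 (2 * (n + Fintype.card (DegIndex n d)))) Q)
    (f : ComplexPoints (regularTotal ℂ n d) → ℝ)
    (hX : haveI := locallyOfFiniteType_regularTotal_hom ℂ n d hd
      haveI := smoothOfRelativeDimension_regularTotal_hom ℂ n d hd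
      letI := ComplexPoints.chartedSpace (regularTotal ℂ n d) (n + Fintype.card (DegIndex n d))
      haveI := ComplexPoints.isManifold_real (regularTotal ℂ n d) (n + Fintype.card (DegIndex n d))
      ContMDiff (𝓡 (2 * (n + Fintype.card (DegIndex n d)))) (𝓡 (2 * (n + Fintype.card (DegIndex n d)))).tangent ∞
        (fun Q => (⟨Q, X Q⟩ : TangentBundle (𝓡 (2 * (n + Fintype.card (DegIndex n d)))) (ComplexPoints (regularTotal ℂ n d)))))
    (hf : haveI := locallyOfFiniteType_regularTotal_hom ℂ n d hd
      haveI := smoothOfRelativeDimension_regularTotal_hom ℂ n d hd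
      letI := ComplexPoints.chartedSpace (regularTotal ℂ n d) (n + Fintype.card (DegIndex n d))
      ContMDiff (𝓡 (2 * (n + Fintype.card (DegIndex n d)))) 𝓘(ℝ, ℝ) ∞ f) :
    haveI := locallyOfFiniteType_regularTotal_hom ℂ n d hd
    haveI := smoothOfRelativeDimension_regularTotal_hom ℂ n d hd
    letI := ComplexPoints.chartedSpace (regularTotal ℂ n d) (n + Fintype.card (DegIndex n d))
    haveI := ComplexPoints.isManifold_real (regularTotal ℂ n d) (n + Fintype.card (DegIndex n d))
    ContMDiff (𝓡 (2 * (n + Fintype.card (DegIndex n d)))) (𝓡 (2 * (n + Fintype.card (DegIndex n d)))).tangent ∞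
      (fun Q => (⟨Q, f Q • X Q⟩ : TangentBundle (𝓡 (2 * (n + Fintype.card (DegIndex n d)))) (ComplexPoints (regularTotal ℂ n d)))) := by
  haveI := locallyOfFiniteType_regularTotal_hom ℂ n d hd
  haveI := smoothOfRelativeDimension_regularTotal_hom ℂ n d hd
  letI := ComplexPoints.chartedSpace (regularTotal ℂ n d) (n + Fintype.card (DegIndex n d))
  haveI := ComplexPoints.isManifold_real (regularTotal ℂ n d) (n + Fintype.card (DegIndex n d))
  exact hf.smul_section hX

/-- **Complete flow of a cut-off field on `𝒴°(ℂ)`**: if `f` vanishes off a compact `K`, the `C^∞` field `f • X` has a global `C^∞` flow with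
the group law, whose orbits are its integral curves, fixing every zero of `f • X`. [cite: LeeSmoothManifolds2013, Thm. 9.16] -/
theorem exists_globalFlow_smul_of_isCompact (hd : 0 < d)
    (X : haveI := locallyOfFiniteType_regularTotal_hom ℂ n d hd
      haveI := smoothOfRelativeDimension_regularTotal_hom ℂ n d hd
      letI := ComplexPoints.chartedSpace (regularTotal ℂ n d) (n + Fintype.card (DegIndex n d))
      Π Q : ComplexPoints (regularTotal ℂ n d), TangentSpace (𝓡 (2 * (n + Fintype.card (DegIndex n d)))) Q)
    (f : ComplexPoints (regularTotal ℂ n d) → ℝ)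
    (hX : haveI := locallyOfFiniteType_regularTotal_hom ℂ n d hd
      haveI := smoothOfRelativeDimension_regularTotal_hom ℂ n d hd
      letI := ComplexPoints.chartedSpace (regularTotal ℂ n d) (n + Fintype.card (DegIndex n d))
      haveI := ComplexPoints.isManifold_real (regularTotal ℂ n d) (n + Fintype.card (DegIndex n d))
      ContMDiff (𝓡 (2 * (n + Fintype.card (DegIndex n d)))) (𝓡 (2 * (n + Fintype.card (DegIndex n d)))).tangent ∞
        (fun Q => (⟨Q, X Q⟩ : TangentBundle (𝓡 (2 * (n + Fintype.card (DegIndex n d)))) (ComplexPoints (regularTotal ℂ n d)))))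
    (hf : haveI := locallyOfFiniteType_regularTotal_hom ℂ n d hd
      haveI := smoothOfRelativeDimension_regularTotal_hom ℂ n d hd
      letI := ComplexPoints.chartedSpace (regularTotal ℂ n d) (n + Fintype.card (DegIndex n d))
      ContMDiff (𝓡 (2 * (n + Fintype.card (DegIndex n d)))) 𝓘(ℝ, ℝ) ∞ f)
    {K : Set (ComplexPoints (regularTotal ℂ n d))} (hK : IsCompact K) (hfK : ∀ Q, Q ∉ K → f Q = 0) :
    haveI := locallyOfFiniteType_regularTotal_hom ℂ n d hd
    haveI := smoothOfRelativeDimension_regularTotal_hom ℂ n d hd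
    letI := ComplexPoints.chartedSpace (regularTotal ℂ n d) (n + Fintype.card (DegIndex n d))
    ∃ θ : ℝ × ComplexPoints (regularTotal ℂ n d) → ComplexPoints (regularTotal ℂ n d),
      ContMDiff (𝓘(ℝ, ℝ).prod (𝓡 (2 * (n + Fintype.card (DegIndex n d))))) (𝓡 (2 * (n + Fintype.card (DegIndex n d)))) ∞ θ ∧
      (∀ Q, θ (0, Q) = Q) ∧ (∀ t s Q, θ (t, θ (s, Q)) = θ (t + s, Q)) ∧
      (∀ Q, IsMIntegralCurve (fun t => θ (t, Q)) (fun Q' => f Q' • X Q')) ∧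
      ∀ Q, f Q • X Q = 0 → ∀ t, θ (t, Q) = Q := by
  haveI := locallyOfFiniteType_regularTotal_hom ℂ n d hd
  haveI := smoothOfRelativeDimension_regularTotal_hom ℂ n d hd
  letI := ComplexPoints.chartedSpace (regularTotal ℂ n d) (n + Fintype.card (DegIndex n d))
  haveI := ComplexPoints.isManifold_real (regularTotal ℂ n d) (n + Fintype.card (DegIndex n d))
  haveI := t2Space_regularTotal n d
  haveI := sigmaCompactSpace_regularTotal n d hd
  have hV := contMDiff_smul_tangentField n d hd X f hX hf
  exact exists_contMDiff_globalFlow_of_eq_zero_off_isCompact (I := 𝓡 (2 * (n + Fintype.card (DegIndex n d))))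
    (V := fun Q' => f Q' • X Q') hV (by exact_mod_cast le_top) hK (fun Q hQ => by rw [hfK Q hQ, zero_smul])

end Literature.AlgebraicGeometry.Motives.UniversalHypersurface

end
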